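import Literature.Dynamics.TransferOperators.MayerTransferOperatorExistence
import Literature.Dynamics.TransferOperators.ZagierPsi
import Mathlib.Analysis.Convex.PathConnected
import Mathlib.Analysis.Complex.CauchyIntegral
import Mathlib.NumberTheory.LSeries.Nonvanishing
import HarnessLib

/-!
# The Chang–Mayer eigenfunction: `1` is an eigenvalue of `L_β` at the zeros of `ζ(2β)`

We discharge the named fact `ChangMayerEigenvalueOne` of `MayerTransferOperator.lean`
[ChangMayer2001, Prop. 4.1(v)]: for `0 < Re β < 1/2` with `ζ(2β) = 0`, Mayer's transfer operator
`L_β` on `B(D)` has the eigenvalue `1`, with eigenfunction `f_β(z) = ψ_β(z+1)`, `ψ_β` Zagier's period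
function of the Eisenstein series (`zagierPsi (2β)`, `ZagierPsi.lean`) continued to the critical
strip. Part 1 of this file is the analytic continuation in `σ = 2β`; Part 2 is the eigenfunction.

## Part 1 — continuation in `σ` of the scalar identities

* `differentiableAt_tsum_hurwitzR_mul_left`, `differentiableAt_zagierPsi_left` — `σ ↦ ψ(σ, v)` is
  holomorphic at every `σ` with `Re σ > 0`, `σ ∉ {1, 2}` (local M-test with the uniform decay bound
  `norm_hurwitzR_le_uniform`; `ζ(σ-1)/(σ-1)` and `ζ(σ)/2` are holomorphic off `{1, 2}`).
* `psiDomain` — the continuation domain `U = {Re σ > 0} ∖ [1, ∞)` (open, star-shaped about `1/2`,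
  hence preconnected; avoids the poles `σ = 1, 2`; contains the strip `0 < Re σ < 1` and the points
  `Re σ > 2`, `Im σ ≠ 0`), and the identity theorem on it (`eqOn_psiDomain_of_eqOn_two_lt`).
* `zagierPsi_lewis` — **the Lewis equation on `U`**, in particular for `0 < Re σ < 1`:
  `ψ(σ, w) - ψ(σ, w+1) = w^{-σ} ψ(σ, 1 + 1/w)` (`Re w > 0`), by analytic continuation from
  `Re σ > 2` [ChangMayer2001, (2.45): "defines for s ∈ ℂ ∖ {1} a holomorphic family of solutions"].
* `zagierPsi_one` — `ψ(σ, 1) = ζ(σ - 1)` on `U` (for `Re σ > 2` this is the antidiagonal count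
  `∑_{m,n ≥ 0} (m+n+1)^{-σ} = ∑ₖ (k+1)^{1-σ}`, `tsum_antidiag_pow`; then continuation).
* `riemannZeta_sub_one_ne_zero` — `ζ(σ - 1) ≠ 0` for `0 < Re σ < 1` (functional equation at
  `s = 2 - σ` and non-vanishing of `ζ` on `Re s ≥ 1`).

## Part 2 — the eigenfunction ([ChangMayer2001, §2.4.6, §3.1 and Cor. 4.3], made unconditional)

With `σ = 2s ∈ U` and `F(u) = ψ(σ, u+1)` (holomorphic on `Re u > -1 ⊇ D̄`):
1. the Lewis equation gives the functional equation (2.47) with `λ = 1`,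
   `F(u) - F(u+1) = (u+1)^{-σ} F(1/(u+1))` (`zagierPsi_add_one_fe`), hence by iteration (2.48)
   `F(z) = F(z+N) + ∑_{n<N} (z+n+1)^{-σ} F(1/(z+n+1))` (`zagierPsi_add_one_iterate`);
2. `∑_{n<N} (z+1+n)^{-σ} = ζ(σ, z+1) - ζ(σ, z+1+N)` (`sum_range_cpow_eq_hurwitzZetaC_sub`), so
   `F(z) - F(0)ζ(σ,z+1) - ∑_{n<N} (z+n+1)^{-σ}(F(1/(z+n+1)) - F(0)) = F(z+N) - F(0) ζ(σ, z+1+N)`;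
3. the ASYMPTOTIC CRITERION (3.6)/(4.15) (`κ = 0`) holds in the quantitative form
   `F(z+N) - F(0) ζ(σ, z+1+N) → ζ(σ)/2` (`tendsto_zagierPsi_sub_mul_hurwitzZetaC`): by
   `ψ(σ,1) = ζ(σ-1)` the growing terms `x^{1-σ}ζ(σ-1)/(σ-1)` (`x = z+1+N`) cancel and the rest is
   `∑ₘ R(σ,(m+1)x) + ζ(σ)/2 - ζ(σ-1)(R(σ,x) + x^{-σ}/2) → ζ(σ)/2`;
4. hence `(L_s F)(z) = F(z) - ζ(2s)/2` on `D̄` (`mayerSum₀_zagierPsi`, `mayerTransfer_zagierPsi_toFun`,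
   using the existence of `L_s` on `B(D)`, `MayerTransferOperatorExistence.lean`) — this is
   [ChangMayer2001, (4.38)] for the trivial representation — and at a zero of `ζ(2s)` the element
   `f_s ∈ B(D)` is an eigenfunction with eigenvalue `1`; it is nonzero because
   `f_s(0) = ψ(2s, 1) = ζ(2s-1) ≠ 0` (`exists_eigenfunction_of_riemannZeta_eq_zero`,
   `ChangMayerEigenvalueOne_holds`).

Chang–Mayer argue instead by meromorphic continuation of both sides of `L_β f_β = f_β + d_β` in
`β`; here everything is proved directly at the given `σ`, the only continuation in `σ` being that
of the scalar identities of Part 1.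

## References

* [ChangMayer2001] C.-H. Chang, D. Mayer, Eigenfunctions of the transfer operators and the period
  functions for modular groups, Contemp. Math. 290 (2001) 1–40: (2.45)–(2.49), (3.6), (4.15),
  Prop. 4.1(v), Prop. 4.2, Cor. 4.3 and (4.33)–(4.38).
* [CM98] C.-H. Chang, D. Mayer, The period function of the nonholomorphic Eisenstein series for
  PSL(2,ℤ), Math. Phys. Electron. J. 4 (1998), paper 6.
* [LZ01] J. Lewis, D. Zagier, Period functions for Maass wave forms. I, Ann. Math. 153 (2001), Ch. IV.
* [Efrat1993] I. Efrat, Dynamics of the continued fraction map and the spectral theory of SL(2,ℤ),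
  Invent. Math. 114 (1993) 207–218.
-/

noncomputable section

open Complex Metric Set Filter Topology Real

namespace Literature.Dynamics.TransferOperators


/-! ### Holomorphy in the exponent `σ` -/

/-- `τ ↦ ζ(τ - 1)` is holomorphic at `τ ≠ 2`. [folklore] -/
theorem differentiableAt_riemannZeta_sub_one {τ : ℂ} (h2 : τ ≠ 2) :
    DifferentiableAt ℂ (fun τ => riemannZeta (τ - 1)) τ := by
  have h : τ - 1 ≠ 1 := fun h => h2 (by linear_combination h)
  exact (differentiableAt_riemannZeta h).comp τ (differentiableAt_id.sub_const 1)

/-- **`σ ↦ ∑ₘ R(σ, (m+1)v)` is holomorphic** at every `σ₀` with `Re σ₀ > 0`, `σ₀ ≠ 1` (`Re v > 0`):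
local M-test with the uniform decay bound. [folklore] -/
theorem differentiableAt_tsum_hurwitzR_mul_left {v : ℂ} (hv : 0 < v.re) {σ₀ : ℂ} (hσ1 : σ₀ ≠ 1)
    (hσ : 0 < σ₀.re) :
    DifferentiableAt ℂ (fun σ => ∑' m : ℕ, hurwitzR σ (((m : ℂ) + 1) * v)) σ₀ := by
  have hd1 : 0 < ‖σ₀ - 1‖ := norm_pos_iff.mpr (sub_ne_zero.mpr hσ1)
  set r : ℝ := min (σ₀.re / 2) (‖σ₀ - 1‖ / 2) with hr
  have hr0 : 0 < r := lt_min (by positivity) (by positivity)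
  have hr1 : r ≤ σ₀.re / 2 := min_le_left _ _
  have hr2 : r ≤ ‖σ₀ - 1‖ / 2 := min_le_right _ _
  set s₁ : ℝ := σ₀.re / 2 with hs₁
  set s₂ : ℝ := σ₀.re + r with hs₂
  set S : ℝ := ‖σ₀‖ + r with hS
  set T : ℝ := |σ₀.im| + r with hT
  have hs₁0 : 0 < s₁ := by rw [hs₁]; positivity
  have hs₂0 : 0 < s₂ := by rw [hs₂]; positivity
  set Z : ℝ := (∑' n : ℕ, ((n : ℝ) + v.re) ^ (-(s₁ / 2 + 1))) +
    ∑' n : ℕ, ((n : ℝ) + v.re) ^ (-(s₂ / 2 + 1)) with hZ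
  set KV : ℝ := S * (S + 1) * Real.exp (π / 2 * T) / 2 with hKV
  -- the summable majorant
  have hmaj : ∀ t : ℝ, 0 < t → Summable fun m : ℕ => (((m : ℝ) + 1) * v.re) ^ (-(t / 2 + 1)) := by
    intro t ht
    have h := (summable_nat_add_rpow_neg (x := 1) one_pos (by positivity : 0 < t / 2)).mul_right
      (v.re ^ (-(t / 2 + 1)))
    refine h.congr fun m => ?_
    rw [Real.mul_rpow (by positivity) hv.le]
  have hsum : Summable fun m : ℕ => KV * ((((m : ℝ) + 1) * v.re) ^ (-(s₁ / 2 + 1)) +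
      (((m : ℝ) + 1) * v.re) ^ (-(s₂ / 2 + 1))) * Z :=
    (((hmaj s₁ hs₁0).add (hmaj s₂ hs₂0)).mul_left KV).mul_right Z
  have hdiff : DifferentiableOn ℂ (fun σ => ∑' m : ℕ, hurwitzR σ (((m : ℂ) + 1) * v)) (ball σ₀ r) := by
    refine Complex.differentiableOn_tsum_of_summable_norm hsum (fun m σ hσV => ?_) isOpen_ball ?_
    · have hb : 0 < (((m : ℂ) + 1) * v).re := by rw [natCast_succ_mul_re]; positivity
      obtain ⟨h₁, -, -, -, h₅⟩ := ball_bounds hr1 hr2 hσV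
      exact (differentiableAt_hurwitzR_left hb h₅ (by linarith)).differentiableWithinAt
    · intro m σ hσV
      obtain ⟨h₁, h₂, h₃, h₄, h₅⟩ := ball_bounds hr1 hr2 hσV
      have hb : v.re ≤ (((m : ℂ) + 1) * v).re := by
        rw [natCast_succ_mul_re]
        have : (1 : ℝ) * v.re ≤ ((m : ℝ) + 1) * v.re :=
          mul_le_mul_of_nonneg_right (by linarith [m.cast_nonneg (α := ℝ)]) hv.le
        linarith
      have h := norm_hurwitzR_le_uniform h₅ h₁ h₂ hs₁0 h₃ h₄ hv hb
      rw [natCast_succ_mul_re] at h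
      exact h
  exact hdiff.differentiableAt (isOpen_ball.mem_nhds (mem_ball_self hr0))

/-- **`σ ↦ ψ(σ, v)` is holomorphic** at every `σ` with `Re σ > 0`, `σ ∉ {1, 2}` (`Re v > 0`).
[folklore] -/
theorem differentiableAt_zagierPsi_left {v : ℂ} (hv : 0 < v.re) {σ : ℂ} (h0 : 0 < σ.re)
    (h1 : σ ≠ 1) (h2 : σ ≠ 2) : DifferentiableAt ℂ (fun τ => zagierPsi τ v) σ := by
  have hv0 : v ≠ 0 := fun h => by rw [h, zero_re] at hv; exact lt_irrefl _ hv
  have hA := differentiableAt_tsum_hurwitzR_mul_left hv h1 h0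
  have hB : DifferentiableAt ℂ (fun τ : ℂ => v ^ (1 - τ) * riemannZeta (τ - 1) / (τ - 1)) σ := by
    exact (((differentiableAt_id.const_sub 1).const_cpow (Or.inl hv0)).mul
      (differentiableAt_riemannZeta_sub_one h2)).div
      (differentiableAt_id.sub_const 1) (sub_ne_zero.mpr h1)
  have hC : DifferentiableAt ℂ (fun τ : ℂ => riemannZeta τ / 2) σ :=
    (differentiableAt_riemannZeta h1).div_const 2
  exact (hA.add hB).add hC

/-! ### The continuation domain -/

/-- The continuation domain `U = {Re σ > 0} ∖ [1, ∞)`: the right half-plane slit along the real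
ray from `1`; it is open, star-shaped about `1/2` (hence connected), avoids the singular points
`1, 2`, contains the half-strip `0 < Re σ < 1` and the points `σ`, `Re σ > 2`, `Im σ ≠ 0`. [folklore] -/
def psiDomain : Set ℂ := {σ : ℂ | 0 < σ.re ∧ (σ.im ≠ 0 ∨ σ.re < 1)}

/-- Membership in the continuation domain. [folklore] -/
theorem mem_psiDomain {σ : ℂ} : σ ∈ psiDomain ↔ 0 < σ.re ∧ (σ.im ≠ 0 ∨ σ.re < 1) := Iff.rfl

/-- The continuation domain is open. [folklore] -/
theorem isOpen_psiDomain : IsOpen psiDomain := by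
  have h1 : IsOpen {σ : ℂ | 0 < σ.re} := isOpen_lt continuous_const Complex.continuous_re
  have h2 : IsOpen {σ : ℂ | σ.im ≠ 0} := isOpen_ne_fun Complex.continuous_im continuous_const
  have h3 : IsOpen {σ : ℂ | σ.re < 1} := isOpen_lt Complex.continuous_re continuous_const
  have : psiDomain = {σ : ℂ | 0 < σ.re} ∩ ({σ : ℂ | σ.im ≠ 0} ∪ {σ : ℂ | σ.re < 1}) := by
    ext σ; simp [psiDomain]
  rw [this]
  exact h1.inter (h2.union h3)

/-- Points of the domain are `≠ 1` and `≠ 2`. [folklore] -/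
theorem ne_one_of_mem_psiDomain {σ : ℂ} (h : σ ∈ psiDomain) : σ ≠ 1 ∧ σ ≠ 2 := by
  obtain ⟨-, h2 | h2⟩ := h
  · exact ⟨fun h => h2 (by simp [h]), fun h => h2 (by simp [h])⟩
  · constructor
    · intro h; rw [h, one_re] at h2; exact lt_irrefl _ h2
    · intro h; rw [h] at h2; norm_num at h2

/-- The domain is star-shaped about `1/2`. [folklore] -/
theorem starConvex_psiDomain : StarConvex ℝ ((1 / 2 : ℝ) : ℂ) psiDomain := by
  rw [starConvex_iff_forall_pos (by norm_num [psiDomain] : ((1 / 2 : ℝ) : ℂ) ∈ psiDomain)]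
  intro y hy a b ha hb hab
  obtain ⟨hyre, hyU⟩ := hy
  have hre : (a • ((1 / 2 : ℝ) : ℂ) + b • y).re = a * (1 / 2) + b * y.re := by
    simp
  have him : (a • ((1 / 2 : ℝ) : ℂ) + b • y).im = b * y.im := by
    simp
  refine ⟨by rw [hre]; positivity, ?_⟩
  rcases hyU with h | h
  · left
    rw [him]
    exact mul_ne_zero hb.ne' h
  · right
    rw [hre]
    nlinarith

/-- The domain is preconnected. [folklore] -/
theorem isPreconnected_psiDomain : IsPreconnected psiDomain :=
  (starConvex_psiDomain.isPathConnected (by norm_num [psiDomain])).isConnected.isPreconnected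

/-- `3 + i ∈ U`, and the Lewis equation holds near it. [folklore] -/
theorem three_add_I_mem_psiDomain : (3 : ℂ) + I ∈ psiDomain := by
  refine ⟨by simp, Or.inl (by simp)⟩

/-- **Zagier's function is holomorphic in `σ` on the domain `U`** (`Re v > 0`). [folklore] -/
theorem differentiableOn_zagierPsi_left {v : ℂ} (hv : 0 < v.re) :
    DifferentiableOn ℂ (fun τ => zagierPsi τ v) psiDomain := fun _ hσ =>
  (differentiableAt_zagierPsi_left hv hσ.1 (ne_one_of_mem_psiDomain hσ).1
    (ne_one_of_mem_psiDomain hσ).2).differentiableWithinAt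

/-- **Identity theorem on `U`**: two functions holomorphic on `U` that agree for `Re σ > 2` agree
on `U`. [folklore] -/
theorem eqOn_psiDomain_of_eqOn_two_lt {f g : ℂ → ℂ} (hf : DifferentiableOn ℂ f psiDomain)
    (hg : DifferentiableOn ℂ g psiDomain) (h : ∀ σ : ℂ, 2 < σ.re → f σ = g σ) :
    EqOn f g psiDomain := by
  have hfa := hf.analyticOnNhd isOpen_psiDomain
  have hga := hg.analyticOnNhd isOpen_psiDomain
  refine hfa.eqOn_of_preconnected_of_eventuallyEq hga isPreconnected_psiDomain
    three_add_I_mem_psiDomain ?_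
  have hopen : IsOpen {σ : ℂ | 2 < σ.re} := isOpen_lt continuous_const Complex.continuous_re
  have hmem : (3 : ℂ) + I ∈ {σ : ℂ | 2 < σ.re} := by
    show (2 : ℝ) < ((3 : ℂ) + I).re
    norm_num
  exact Filter.eventuallyEq_of_mem (hopen.mem_nhds hmem) fun σ hσ => h σ hσ

/-- **The Lewis equation for the continued function**: for `σ ∈ U` (in particular for
`0 < Re σ < 1`) and `Re w > 0`, `ψ(σ, w) - ψ(σ, w+1) = w^{-σ} ψ(σ, 1 + 1/w)`, by analytic
continuation in `σ` from `Re σ > 2`. [cite: ChangMayer2001, (2.45) and Prop. 4.2] -/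
theorem zagierPsi_lewis {σ w : ℂ} (hσ : σ ∈ psiDomain) (hw : 0 < w.re) :
    zagierPsi σ w - zagierPsi σ (w + 1) = w ^ (-σ) * zagierPsi σ (1 + 1 / w) := by
  have hw1 : 0 < (w + 1).re := by simp only [add_re, one_re]; linarith
  have hw2 : 0 < (1 + 1 / w).re := one_add_one_div_re_pos hw
  have hw0 : w ≠ 0 := fun h => by rw [h, zero_re] at hw; exact lt_irrefl _ hw
  have hf : DifferentiableOn ℂ (fun τ => zagierPsi τ w - zagierPsi τ (w + 1)) psiDomain :=
    (differentiableOn_zagierPsi_left hw).sub (differentiableOn_zagierPsi_left hw1)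
  have hg : DifferentiableOn ℂ (fun τ => w ^ (-τ) * zagierPsi τ (1 + 1 / w)) psiDomain :=
    DifferentiableOn.mul (fun τ _ => (differentiableAt_id.neg.const_cpow
      (Or.inl hw0)).differentiableWithinAt) (differentiableOn_zagierPsi_left hw2)
  exact eqOn_psiDomain_of_eqOn_two_lt hf hg (fun τ hτ => zagierPsi_lewis_of_two_lt hτ hw) hσ

/-! ### The value `ψ(σ, 1) = ζ(σ - 1)` -/

/-- The family `(m, n) ↦ (n + m + 1)^{-σ}` is absolutely summable on `ℕ × ℕ` for `Re σ > 2`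
(its norm is at most `e^{π|Im σ|/2} ((m+1)(n+1))^{-Re σ/2}`). [folklore] -/
theorem summable_antidiag_pow {σ : ℂ} (hσ : 2 < σ.re) :
    Summable fun p : ℕ × ℕ => ((p.2 : ℂ) + ((p.1 : ℂ) + 1) * 1) ^ (-σ) := by
  set E : ℝ := Real.exp (π / 2 * |σ.im|) with hE
  set f : ℕ → ℝ := fun m => ((m : ℝ) + 1) ^ (-(σ.re / 2)) with hf
  have hfs : Summable f := by
    have h := summable_nat_add_rpow_neg (x := 1) one_pos (by linarith : 0 < σ.re / 2 - 1)
    refine h.congr fun m => ?_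
    simp only [hf]
    ring_nf
  have hf0 : 0 ≤ f := fun m => Real.rpow_nonneg (by positivity) _
  have hprod := (hfs.mul_of_nonneg hfs hf0 hf0).mul_left E
  refine Summable.of_norm_bounded hprod fun p => ?_
  obtain ⟨m, n⟩ := p
  have hre : (((n : ℂ) + ((m : ℂ) + 1) * 1)).re = (n : ℝ) + m + 1 := by
    simp only [mul_one, add_re, natCast_re, one_re]; ring
  have hpos : 0 < (((n : ℂ) + ((m : ℂ) + 1) * 1)).re := by rw [hre]; positivity
  have hw' : (-σ).re ≤ 0 := by simp; linarith
  refine (norm_cpow_le_re_rpow_of_re_pos hpos hw').trans ?_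
  rw [neg_re, neg_im, abs_neg, hre, mul_comm]
  change E * (((n : ℝ) + m + 1) ^ (-σ.re)) ≤ E * (f m * f n)
  refine mul_le_mul_of_nonneg_left ?_ (Real.exp_pos _).le
  have hX : 0 < (m : ℝ) + 1 := by positivity
  have hY : 0 < (n : ℝ) + 1 := by positivity
  have hXY : Real.sqrt (((m : ℝ) + 1) * ((n : ℝ) + 1)) ≤ (n : ℝ) + m + 1 := by
    rw [Real.sqrt_le_left (by positivity)]
    nlinarith [m.cast_nonneg (α := ℝ), n.cast_nonneg (α := ℝ)]
  calc ((n : ℝ) + m + 1) ^ (-σ.re)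
      ≤ (Real.sqrt (((m : ℝ) + 1) * ((n : ℝ) + 1))) ^ (-σ.re) :=
        Real.rpow_le_rpow_of_nonpos (Real.sqrt_pos.mpr (by positivity)) hXY (by linarith)
    _ = f m * f n := by
        simp only [hf]
        rw [Real.sqrt_eq_rpow, ← Real.rpow_mul (by positivity), Real.mul_rpow hX.le hY.le]
        ring_nf

/-- **Antidiagonal evaluation**: `∑_{(m,n)} (n+m+1)^{-σ} = ζ(σ - 1)` for `Re σ > 2` (the
antidiagonal `m + n = k` contributes `(k+1) · (k+1)^{-σ} = (k+1)^{1-σ}`). [folklore] -/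
theorem tsum_antidiag_pow {σ : ℂ} (hσ : 2 < σ.re) :
    ∑' p : ℕ × ℕ, ((p.2 : ℂ) + ((p.1 : ℂ) + 1) * 1) ^ (-σ) = riemannZeta (σ - 1) := by
  set G : ℕ × ℕ → ℂ := fun p => ((p.2 : ℂ) + ((p.1 : ℂ) + 1) * 1) ^ (-σ) with hG
  have hGs : Summable G := summable_antidiag_pow hσ
  set e := (Finset.HasAntidiagonal.sigmaAntidiagonalEquivProd (A := ℕ)) with he
  have hGe : Summable (G ∘ e) := e.summable_iff.mpr hGs
  have hfib : ∀ k : ℕ, HasSum (fun c : Finset.antidiagonal k => (G ∘ e) ⟨k, c⟩)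
      (((k : ℂ) + 1) * ((k : ℂ) + 1) ^ (-σ)) := by
    intro k
    have h1 := hasSum_fintype (fun c : Finset.antidiagonal k => (G ∘ e) ⟨k, c⟩)
    convert h1 using 1
    have hfun : (fun c : Finset.antidiagonal k => (G ∘ e) ⟨k, c⟩) =
        fun c : Finset.antidiagonal k => ((k : ℂ) + 1) ^ (-σ) := by
      funext c
      obtain ⟨⟨i, j⟩, hij⟩ := c
      have hk : ((k : ℕ) : ℂ) = (i : ℂ) + (j : ℂ) := by
        rw [Finset.mem_antidiagonal] at hij
        exact_mod_cast hij.symm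
      simp only [Function.comp_apply, he, Finset.HasAntidiagonal.sigmaAntidiagonalEquivProd_apply, hG]
      rw [hk]
      congr 1
      ring
    rw [hfun, Finset.sum_const, Finset.card_univ, Fintype.card_coe, Finset.Nat.card_antidiagonal,
      nsmul_eq_mul]
    push_cast
    ring
  have h := (hGe.hasSum.sigma hfib).tsum_eq
  rw [show (∑' b : (Σ n : ℕ, Finset.antidiagonal n), (G ∘ e) b) = ∑' p, G p from e.tsum_eq G] at h
  rw [← h]
  have hz := (hasSum_natCast_succ_cpow_neg (τ := σ - 1) (by simp only [sub_re, one_re]; linarith)).tsum_eq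
  rw [← hz]
  refine tsum_congr fun k => ?_
  have hk : (k : ℂ) + 1 ≠ 0 := by
    intro h; have := congrArg Complex.re h; simp at this; linarith [k.cast_nonneg (α := ℝ)]
  rw [show -(σ - 1) = 1 + -σ by ring, cpow_add _ _ hk, cpow_one]

/-- `ψ(σ, 1) = ζ(σ - 1)` for `Re σ > 2` (`= ∑_{m,n ≥ 0} (m+n+1)^{-σ}`; [Zagier]: `ψ_s(1) = ζ(2s-1)`).
[folklore] -/
theorem zagierPsi_one_of_two_lt {σ : ℂ} (hσ : 2 < σ.re) : zagierPsi σ 1 = riemannZeta (σ - 1) := by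
  have hG := summable_antidiag_pow hσ
  rw [zagierPsi_eq_tsum_add hσ (by simp : (0 : ℝ) < (1 : ℂ).re), one_cpow, sub_self, mul_zero,
    add_zero, ← tsum_antidiag_pow hσ]
  exact (hG.tsum_prod' fun m => hG.prod_factor m).symm

/-- **`ψ(σ, 1) = ζ(σ - 1)` on the domain `U`** (in particular for `0 < Re σ < 1`), by analytic
continuation from `Re σ > 2`. [folklore] -/
theorem zagierPsi_one {σ : ℂ} (hσ : σ ∈ psiDomain) : zagierPsi σ 1 = riemannZeta (σ - 1) := by
  have hf : DifferentiableOn ℂ (fun τ => zagierPsi τ 1) psiDomain :=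
    differentiableOn_zagierPsi_left (by simp)
  have hg : DifferentiableOn ℂ (fun τ => riemannZeta (τ - 1)) psiDomain := fun τ hτ =>
    (differentiableAt_riemannZeta_sub_one (ne_one_of_mem_psiDomain hτ).2).differentiableWithinAt
  exact eqOn_psiDomain_of_eqOn_two_lt hf hg (fun τ hτ => zagierPsi_one_of_two_lt hτ) hσ

/-- **`ζ(σ - 1) ≠ 0` for `0 < Re σ < 1`**: by the functional equation
`ζ(1-s) = 2 (2π)^{-s} Γ(s) cos(πs/2) ζ(s)` at `s = 2 - σ` (`1 < Re s < 2`), where no factor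
vanishes (`ζ(s) ≠ 0` for `Re s ≥ 1`). [folklore] -/
theorem riemannZeta_sub_one_ne_zero {σ : ℂ} (h0 : 0 < σ.re) (h1 : σ.re < 1) :
    riemannZeta (σ - 1) ≠ 0 := by
  set s : ℂ := 2 - σ with hs
  have hsre : s.re = 2 - σ.re := by simp [hs]
  have hs1 : 1 < s.re := by rw [hsre]; linarith
  have hs2 : s.re < 2 := by rw [hsre]; linarith
  have hnat : ∀ n : ℕ, s ≠ -n := fun n h => by
    have := congrArg Complex.re h
    simp only [neg_re, natCast_re] at this
    linarith [n.cast_nonneg (α := ℝ)]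
  have hne1 : s ≠ 1 := fun h => by rw [h, one_re] at hs1; exact lt_irrefl _ hs1
  have hfe := riemannZeta_one_sub hnat hne1
  rw [show 1 - s = σ - 1 by rw [hs]; ring] at hfe
  rw [hfe]
  have hπ : (π : ℂ) ≠ 0 := ofReal_ne_zero.mpr Real.pi_ne_zero
  refine mul_ne_zero (mul_ne_zero (mul_ne_zero (mul_ne_zero two_ne_zero ?_) ?_) ?_) ?_
  · rw [Ne, cpow_eq_zero_iff, not_and_or]
    exact Or.inl (mul_ne_zero two_ne_zero hπ)
  · exact Complex.Gamma_ne_zero_of_re_pos (by linarith)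
  · intro hcos
    rw [Complex.cos_eq_zero_iff] at hcos
    obtain ⟨k, hk⟩ := hcos
    have h3 : (π : ℂ) * s = (π : ℂ) * (2 * k + 1) := by linear_combination 2 * hk
    have h4 : s = 2 * k + 1 := mul_left_cancel₀ hπ h3
    have := congrArg Complex.re h4
    simp at this
    -- `s.re = 2k + 1` with `1 < s.re < 2` is impossible for an integer `k`
    have hk1 : (0 : ℝ) < k := by linarith
    have hk3 : (0 : ℤ) < k := by exact_mod_cast hk1
    have hk4 : (k : ℝ) < 1 := by linarith
    have hk5 : k < (1 : ℤ) := by exact_mod_cast hk4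
    omega
  · exact riemannZeta_ne_zero_of_one_le_re hs1.le


/-! ### The candidate `F(u) = ψ(σ, u + 1)` -/

/-- `u ↦ ψ(σ, u+1)` is holomorphic on the half-plane `Re u > -1` (`σ ≠ 1`, `Re σ > 0`). [folklore] -/
theorem differentiableOn_zagierPsi_add_one {σ : ℂ} (hσ1 : σ ≠ 1) (hσ : 0 < σ.re) :
    DifferentiableOn ℂ (fun u : ℂ => zagierPsi σ (u + 1)) {u : ℂ | -1 < u.re} := by
  refine (differentiableOn_zagierPsi_right hσ1 hσ).comp (differentiableOn_id.add_const 1) ?_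
  intro u hu
  have hu' : (-1 : ℝ) < u.re := hu
  show (0 : ℝ) < (u + 1).re
  simp only [add_re, one_re]
  linarith

/-- `u ↦ ψ(σ, u+1)` is continuous on the closed disc `D̄`. [folklore] -/
theorem continuousOn_zagierPsi_add_one {σ : ℂ} (hσ1 : σ ≠ 1) (hσ : 0 < σ.re) :
    ContinuousOn (fun u : ℂ => zagierPsi σ (u + 1)) mayerClosedDisc :=
  (differentiableOn_zagierPsi_add_one hσ1 hσ).continuousOn.mono mayerClosedDisc_subset_halfPlane

/-- `u ↦ ψ(σ, u+1)` is holomorphic on Mayer's disc `D`. [folklore] -/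
theorem differentiableOn_zagierPsi_add_one_mayerDisc {σ : ℂ} (hσ1 : σ ≠ 1) (hσ : 0 < σ.re) :
    DifferentiableOn ℂ (fun u : ℂ => zagierPsi σ (u + 1)) mayerDisc :=
  (differentiableOn_zagierPsi_add_one hσ1 hσ).mono
    (mayerDisc_subset_mayerClosedDisc.trans mayerClosedDisc_subset_halfPlane)

/-- **The functional equation (2.47) of Chang–Mayer for `F(u) = ψ(σ, u+1)`** (`λ = 1`):
`F(u) - F(u+1) = (u+1)^{-σ} F(1/(u+1))` for `Re u > -1`, `σ ∈ U`. [cite: ChangMayer2001, (2.47)–(2.49)] -/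
theorem zagierPsi_add_one_fe {σ u : ℂ} (hσ : σ ∈ psiDomain) (hu : -1 < u.re) :
    zagierPsi σ (u + 1) - zagierPsi σ (u + 1 + 1) =
      (u + 1) ^ (-σ) * zagierPsi σ (1 / (u + 1) + 1) := by
  have hw : 0 < (u + 1).re := by simp only [add_re, one_re]; linarith
  rw [zagierPsi_lewis hσ hw, add_comm (1 / (u + 1)) 1]

/-- **Iterating the functional equation** ([ChangMayer2001, (2.48)]): for `Re z > -1` and every `N`,
`F(z) = F(z+N) + ∑_{n<N} (z+n+1)^{-σ} F(1/(z+n+1))`. [cite: ChangMayer2001, (2.48)] -/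
theorem zagierPsi_add_one_iterate {σ z : ℂ} (hσ : σ ∈ psiDomain) (hz : -1 < z.re) (N : ℕ) :
    zagierPsi σ (z + 1) = zagierPsi σ (z + N + 1) +
      ∑ n ∈ Finset.range N, (z + (n + 1)) ^ (-σ) * zagierPsi σ (1 / (z + (n + 1)) + 1) := by
  induction N with
  | zero => simp
  | succ N ih =>
    rw [Finset.sum_range_succ, ih]
    have hu : -1 < (z + N).re := by
      simp only [add_re, natCast_re]; linarith [N.cast_nonneg (α := ℝ)]
    have hfe := zagierPsi_add_one_fe hσ hu
    have e1 : z + (N : ℂ) + 1 + 1 = z + ((N + 1 : ℕ) : ℂ) + 1 := by push_cast; ring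
    have e2 : z + (N : ℂ) + 1 = z + ((N : ℂ) + 1) := by ring
    rw [e1] at hfe
    rw [← e2]
    linear_combination hfe

/-- **Finite difference equation of the Hurwitz zeta function**: for `σ ≠ 1`, `Re σ > 0`,
`Re a > 0`: `∑_{n<N} (a+n)^{-σ} = ζ(σ, a) - ζ(σ, a+N)`. [folklore] -/
theorem sum_range_cpow_eq_hurwitzZetaC_sub {σ a : ℂ} (hσ1 : σ ≠ 1) (hσ : 0 < σ.re) (ha : 0 < a.re)
    (N : ℕ) : ∑ n ∈ Finset.range N, (a + n) ^ (-σ) = hurwitzZetaC σ a - hurwitzZetaC σ (a + N) := by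
  induction N with
  | zero => simp
  | succ N ih =>
    rw [Finset.sum_range_succ, ih]
    have haN : 0 < (a + N).re := by simp only [add_re, natCast_re]; linarith [N.cast_nonneg (α := ℝ)]
    have h := hurwitzZetaC_sub_add_one hσ1 hσ haN
    have e1 : a + (N : ℂ) + 1 = a + ((N + 1 : ℕ) : ℂ) := by push_cast; ring
    rw [e1] at h
    linear_combination -h

/-! ### The limit `N → ∞` -/

/-- Sequences dominated by `C (a + N)^{-t}` (`t > 0`) tend to zero. [folklore] -/
theorem tendsto_zero_of_norm_le_rpow {g : ℕ → ℂ} {C a t : ℝ} (ht : 0 < t)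
    (h : ∀ N : ℕ, ‖g N‖ ≤ C * (a + N) ^ (-t)) : Tendsto g atTop (𝓝 0) := by
  rw [tendsto_zero_iff_norm_tendsto_zero]
  have h1 : Tendsto (fun N : ℕ => (a + N : ℝ) ^ (-t)) atTop (𝓝 0) := by
    have hN : Tendsto (fun N : ℕ => (a + N : ℝ)) atTop atTop :=
      tendsto_atTop_add_const_left _ _ tendsto_natCast_atTop_atTop
    exact (tendsto_rpow_neg_atTop ht).comp hN
  have h2 : Tendsto (fun N : ℕ => C * (a + N : ℝ) ^ (-t)) atTop (𝓝 0) := by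
    simpa using h1.const_mul C
  refine squeeze_zero (fun N => norm_nonneg _) h h2

/-- **The asymptotic criterion** ([ChangMayer2001, (3.6)/(4.15) with `κ = 0`], made quantitative):
for `σ ∈ U`, `Re z > -1`,
`F(z+N) - ψ(σ,1) ζ(σ, z+1+N) ⟶ ζ(σ)/2` as `N → ∞`, where `F(u) = ψ(σ, u+1)` and `ψ(σ, 1) = ζ(σ-1)`:
writing `x = z + 1 + N`, the growing terms `x^{1-σ} ζ(σ-1)/(σ-1)` of `ψ(σ, x)` and of
`ζ(σ-1) ζ(σ, x)` cancel, and what remains is `∑ₘ R(σ,(m+1)x) + ζ(σ)/2 - ζ(σ-1)(R(σ,x) + x^{-σ}/2) → ζ(σ)/2`.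
[cite: ChangMayer2001, (4.15)] -/
theorem tendsto_zagierPsi_sub_mul_hurwitzZetaC {σ z : ℂ} (hσ : σ ∈ psiDomain) (hz : -1 < z.re) :
    Tendsto (fun N : ℕ => zagierPsi σ (z + N + 1) - zagierPsi σ 1 * hurwitzZetaC σ (z + 1 + N))
      atTop (𝓝 (riemannZeta σ / 2)) := by
  obtain ⟨hσ1, -⟩ := ne_one_of_mem_psiDomain hσ
  have hσ0 : 0 < σ.re := hσ.1
  have hz1 : 0 < (z + 1).re := by simp only [add_re, one_re]; linarith
  -- `x_N = z + 1 + N`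
  have hx : ∀ N : ℕ, 0 < (z + 1 + N).re ∧ (z + 1).re ≤ (z + 1 + N).re := fun N => by
    simp only [add_re, one_re, natCast_re]
    constructor <;> linarith [N.cast_nonneg (α := ℝ)]
  -- decomposition of the `N`-th term
  have hdec : ∀ N : ℕ, zagierPsi σ (z + N + 1) - zagierPsi σ 1 * hurwitzZetaC σ (z + 1 + N) =
      (∑' m : ℕ, hurwitzR σ (((m : ℂ) + 1) * (z + 1 + N))) + riemannZeta σ / 2 -
        riemannZeta (σ - 1) * (hurwitzR σ (z + 1 + N) + (z + 1 + N) ^ (-σ) / 2) := by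
    intro N
    have hR := hurwitzR_eq_hurwitzZetaC_sub hσ1 hσ0 (hx N).1
    rw [show z + (N : ℂ) + 1 = z + 1 + N by ring, zagierPsi_def, zagierPsi_one hσ]
    rw [show hurwitzZetaC σ (z + 1 + N) = hurwitzR σ (z + 1 + N) + (z + 1 + N) ^ (1 - σ) / (σ - 1) +
      (z + 1 + N) ^ (-σ) / 2 by rw [hR]; ring]
    ring
  simp_rw [hdec]
  -- the three small terms
  set t : ℝ := σ.re / 2 + 1 with ht
  have ht0 : 0 < t := by positivity
  have hre : ∀ N : ℕ, (z + 1 + N).re = (z + 1).re + N := fun N => by simp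
  have hA : Tendsto (fun N : ℕ => ∑' m : ℕ, hurwitzR σ (((m : ℂ) + 1) * (z + 1 + N))) atTop (𝓝 0) := by
    refine tendsto_zero_of_norm_le_rpow (a := (z + 1).re) (C := trapConst σ *
      (∑' n : ℕ, ((n : ℝ) + (z + 1).re) ^ (-t)) * (∑' m : ℕ, ((m : ℝ) + 1) ^ (-t))) ht0 (fun N => ?_)
    have h := norm_tsum_hurwitzR_mul_le hσ1 hσ0 hz1 (hx N).2
    rw [hre N] at h
    exact h
  have hB : Tendsto (fun N : ℕ => hurwitzR σ (z + 1 + N)) atTop (𝓝 0) := by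
    refine tendsto_zero_of_norm_le_rpow (a := (z + 1).re) (C := trapConst σ *
      ∑' n : ℕ, ((n : ℝ) + (z + 1).re) ^ (-(σ.re / 2 + 1))) ht0 (fun N => ?_)
    have h := norm_hurwitzR_le_decay hσ1 hσ0 hz1 (hx N).2
    rw [hre N] at h
    calc ‖hurwitzR σ (z + 1 + N)‖ ≤ trapConst σ * ((z + 1).re + N) ^ (-(σ.re / 2 + 1)) *
          ∑' n : ℕ, ((n : ℝ) + (z + 1).re) ^ (-(σ.re / 2 + 1)) := h
      _ = (trapConst σ * ∑' n : ℕ, ((n : ℝ) + (z + 1).re) ^ (-(σ.re / 2 + 1))) *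
          ((z + 1).re + N) ^ (-t) := by rw [ht]; ring
  have hC : Tendsto (fun N : ℕ => (z + 1 + N) ^ (-σ)) atTop (𝓝 0) := by
    have h := tendsto_natCast_add_cpow_neg (b := z + 1) hz1 hσ0
    refine h.congr fun N => ?_
    rw [add_comm]
  have hlim := (hA.add_const (riemannZeta σ / 2)).sub
    ((hB.add (hC.div_const 2)).const_mul (riemannZeta (σ - 1)))
  simp only [zero_add, zero_div, add_zero, mul_zero, sub_zero] at hlim
  exact hlim

/-! ### The pointwise identity `(L_s F)(z) = F(z) - ζ(2s)/2` -/

/-- `mayerSum₀` only sees the values of `F` on the closed disc. [folklore] -/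
theorem mayerSum₀_congr {s : ℂ} {F G : ℂ → ℂ} (h : ∀ u ∈ mayerClosedDisc, F u = G u) {z : ℂ}
    (hz : z ∈ mayerClosedDisc) : mayerSum₀ s F z = mayerSum₀ s G z := by
  simp only [mayerSum₀, mayerTerm]
  rw [h 0 zero_mem_mayerClosedDisc]
  congr 1
  refine tsum_congr fun n => ?_
  rw [h _ (one_div_add_mem_mayerClosedDisc hz n)]

/-- **The pointwise identity** ([ChangMayer2001, (4.36)–(4.38) for `χ₁`]): for `σ = 2s ∈ U` and
`z ∈ D̄`, with `F(u) = ψ(σ, u+1)`,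
`F(0) ζ(σ, z+1) + ∑_{n≥0} (z+n+1)^{-σ} (F(1/(z+n+1)) - F(0)) = F(z) - ζ(σ)/2`,
i.e. `(L_s F)(z) = F(z) - ζ(2s)/2`: iterate the functional equation `N` times, rewrite the
partial Hurwitz sums with the difference equation, and let `N → ∞` using the asymptotic criterion.
[cite: ChangMayer2001, Prop. 4.1(v) and Cor. 4.3] -/
theorem mayerSum₀_zagierPsi {s : ℂ} (hσ : 2 * s ∈ psiDomain) {z : ℂ} (hz : z ∈ mayerClosedDisc) :
    mayerSum₀ s (fun u => zagierPsi (2 * s) (u + 1)) z =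
      zagierPsi (2 * s) (z + 1) - riemannZeta (2 * s) / 2 := by
  obtain ⟨hσ1, -⟩ := ne_one_of_mem_psiDomain hσ
  have hσ0 : 0 < (2 * s).re := hσ.1
  have hs0 : 0 < s.re := by simp at hσ0; linarith
  have hz' : -1 < z.re := mayerClosedDisc_subset_halfPlane hz
  have hz1 : 0 < (z + 1).re := by simp only [add_re, one_re]; linarith
  set F : ℂ → ℂ := fun u => zagierPsi (2 * s) (u + 1) with hF
  -- summability of the term series, via the element of `B(D)`
  set f : MayerSpace := MayerSpace.mk F (continuousOn_zagierPsi_add_one hσ1 hσ0)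
    (differentiableOn_zagierPsi_add_one_mayerDisc hσ1 hσ0) with hf
  have hterm : ∀ n, mayerTerm s (fun w => f.toFun w - f.toFun 0) n z =
      mayerTerm s (fun w => F w - F 0) n z := by
    intro n
    simp only [mayerTerm]
    rw [MayerSpace.mk_toFun_apply _ _ _ (one_div_add_mem_mayerClosedDisc hz n),
      MayerSpace.mk_toFun_apply _ _ _ zero_mem_mayerClosedDisc]
  have hsum : Summable fun n => mayerTerm s (fun w => F w - F 0) n z :=
    (summable_mayerTerm_sub f hz hs0).congr hterm
  -- the identity at level `N`
  have hN : ∀ N : ℕ, F z - F 0 * hurwitzZetaC (2 * s) (z + 1) -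
      ∑ n ∈ Finset.range N, mayerTerm s (fun w => F w - F 0) n z =
      F (z + N) - F 0 * hurwitzZetaC (2 * s) (z + 1 + N) := by
    intro N
    have hit := zagierPsi_add_one_iterate hσ hz' N
    have hhur := sum_range_cpow_eq_hurwitzZetaC_sub hσ1 hσ0 hz1 N
    have hsplit : ∑ n ∈ Finset.range N, mayerTerm s (fun w => F w - F 0) n z =
        ∑ n ∈ Finset.range N, (z + (n + 1)) ^ (-(2 * s)) * zagierPsi (2 * s) (1 / (z + (n + 1)) + 1) -
          F 0 * ∑ n ∈ Finset.range N, (z + 1 + n) ^ (-(2 * s)) := by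
      rw [Finset.mul_sum, ← Finset.sum_sub_distrib]
      refine Finset.sum_congr rfl fun n _ => ?_
      simp only [mayerTerm, hF]
      rw [show z + 1 + (n : ℂ) = z + ((n : ℂ) + 1) by ring]
      ring
    rw [hsplit, hhur]
    simp only [hF]
    rw [hit]
    ring
  -- the two limits
  have hlim1 : Tendsto (fun N : ℕ => F z - F 0 * hurwitzZetaC (2 * s) (z + 1) -
      ∑ n ∈ Finset.range N, mayerTerm s (fun w => F w - F 0) n z) atTop
      (𝓝 (F z - F 0 * hurwitzZetaC (2 * s) (z + 1) - ∑' n, mayerTerm s (fun w => F w - F 0) n z)) :=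
    hsum.hasSum.tendsto_sum_nat.const_sub _
  have hlim2 : Tendsto (fun N : ℕ => F (z + N) - F 0 * hurwitzZetaC (2 * s) (z + 1 + N)) atTop
      (𝓝 (riemannZeta (2 * s) / 2)) := by
    refine (tendsto_zagierPsi_sub_mul_hurwitzZetaC hσ hz').congr fun N => ?_
    simp only [hF, zero_add]
  have heq := tendsto_nhds_unique (hlim1.congr hN) hlim2
  rw [mayerSum₀]
  simp only [hF] at heq ⊢
  linear_combination (-1 : ℂ) * heq

/-! ### The eigenfunction -/

/-- **The Chang–Mayer eigenfunction identity on `B(D)`**: for `σ = 2s ∈ U` (so `0 < Re s`,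
`s ≠ 1/2`), the element `f_s ∈ B(D)` given by `f_s(z) = ψ(2s, z+1)` satisfies
`(L_s f_s)(z) = f_s(z) - ζ(2s)/2` on `D̄`. [cite: ChangMayer2001, Prop. 4.1(v) and Cor. 4.3] -/
theorem mayerTransfer_zagierPsi_toFun {s : ℂ} (hσ : 2 * s ∈ psiDomain) (z : mayerClosedDisc) :
    (mayerTransfer s (MayerSpace.mk (fun u => zagierPsi (2 * s) (u + 1))
      (continuousOn_zagierPsi_add_one (ne_one_of_mem_psiDomain hσ).1 hσ.1)
      (differentiableOn_zagierPsi_add_one_mayerDisc (ne_one_of_mem_psiDomain hσ).1 hσ.1))).toFun z =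
      zagierPsi (2 * s) (z + 1) - riemannZeta (2 * s) / 2 := by
  have hσ1 := (ne_one_of_mem_psiDomain hσ).1
  have hσ0 : 0 < (2 * s).re := hσ.1
  have hs0 : 0 < s.re := by simp at hσ0; linarith
  have hs' : s ≠ 1 / 2 := fun h => hσ1 (by rw [h]; norm_num)
  rw [mayerTransfer_toFun_apply_of_re_pos hs0 hs' _ z]
  rw [mayerSum₀_congr (G := fun u => zagierPsi (2 * s) (u + 1))
    (fun u hu => MayerSpace.mk_toFun_apply (fun u => zagierPsi (2 * s) (u + 1)) _ _ hu) z.2]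
  exact mayerSum₀_zagierPsi hσ z.2

/-- **Eigenvalue `1` at the zeros of `ζ(2s)`** (Chang–Mayer [ChangMayer2001, Prop. 4.1(v)], going
back to Efrat and Lewis–Zagier): if `2s ∈ U` and `ζ(2s) = 0` then `f_s(z) = ψ(2s, z+1)` is an
eigenfunction of `L_s` with eigenvalue `1`, and `f_s ≠ 0` when moreover `Re s < 1/2`
(`f_s(0) = ψ(2s, 1) = ζ(2s - 1) ≠ 0`). [cite: ChangMayer2001, Prop. 4.1(v)] -/
theorem exists_eigenfunction_of_riemannZeta_eq_zero {s : ℂ} (hs0 : 0 < s.re) (hs1 : s.re < 1 / 2)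
    (hζ : riemannZeta (2 * s) = 0) :
    ∃ f : MayerSpace, f ≠ 0 ∧ mayerTransfer s f = f ∧
      ∀ z ∈ mayerClosedDisc, f.toFun z = zagierPsi (2 * s) (z + 1) := by
  have hσ0 : 0 < (2 * s).re := by simp; linarith
  have hσ1' : (2 * s).re < 1 := by simp; linarith
  have hσ : 2 * s ∈ psiDomain := ⟨hσ0, Or.inr hσ1'⟩
  have hσ1 := (ne_one_of_mem_psiDomain hσ).1
  set f : MayerSpace := MayerSpace.mk (fun u => zagierPsi (2 * s) (u + 1))
      (continuousOn_zagierPsi_add_one (ne_one_of_mem_psiDomain hσ).1 hσ.1)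
      (differentiableOn_zagierPsi_add_one_mayerDisc (ne_one_of_mem_psiDomain hσ).1 hσ.1) with hf
  have hval : ∀ z ∈ mayerClosedDisc, f.toFun z = zagierPsi (2 * s) (z + 1) := fun z hz =>
    MayerSpace.mk_toFun_apply _ _ _ hz
  refine ⟨f, fun h0 => ?_, MayerSpace.ext fun z hz => ?_, hval⟩
  · -- `f 0 = ψ(2s, 1) = ζ(2s - 1) ≠ 0`
    have h1 : f.toFun 0 = riemannZeta (2 * s - 1) := by
      rw [hval 0 zero_mem_mayerClosedDisc, zero_add, zagierPsi_one hσ]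
    have h2 : f.toFun 0 = 0 := by
      rw [h0]
      simp [MayerSpace.toFun]
    exact riemannZeta_sub_one_ne_zero hσ0 hσ1' (h1.symm.trans h2)
  · rw [mayerTransfer_zagierPsi_toFun hσ ⟨z, hz⟩, hζ, zero_div, sub_zero, hval z hz]

/-- **Discharge of the named fact `ChangMayerEigenvalueOne`** [ChangMayer2001, Prop. 4.1(v)]: for
`0 < Re β < 1/2` with `ζ(2β) = 0`, `1` is an eigenvalue of Mayer's transfer operator `L_β` on
`B(D)`; the eigenfunction is `f_β(z) = ψ_β(z+1)` with `ψ_β` Zagier's (continued) period function of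
the Eisenstein series (`zagierPsi (2β)`). [cite: ChangMayer2001, Prop. 4.1(v)] -/
theorem ChangMayerEigenvalueOne_holds : ChangMayerEigenvalueOne := by
  intro β h0 h1 hζ
  obtain ⟨f, hf0, hf1, -⟩ := exists_eigenfunction_of_riemannZeta_eq_zero h0 h1 hζ
  exact ⟨f, hf0, hf1⟩

end Literature.Dynamics.TransferOperators
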